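import Mathlib.Data.Matrix.ColumnRowPartitioned
import Mathlib.Data.Matrix.Composition
import Mathlib.LinearAlgebra.Matrix.Kronecker
import HarnessLib

/-!
# The lifted product `LP(A, B)` of two matrices over a matrix ring (Panteleev–Kalachev)

Source: P. Panteleev, G. Kalachev, *Quantum LDPC codes with almost linear minimum distance*,
IEEE Trans. Inform. Theory 68 (2022) 213–229 = arXiv:2012.04068, §III.D "Lifted product (LP) codes"
[PanteleevKalachev2022LP] (held text `paper:arxiv-2012.04068`, chunk p0011 L1–45), and the same
construction over an arbitrary finite field, with the sign needed outside characteristic two, in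
P. Panteleev, G. Kalachev, *Asymptotically good quantum and locally testable classical LDPC codes*,
STOC 2022 = arXiv:2111.03654, Appendix "Lifted product of two classical codes", eq. (LP)
[PanteleevKalachev2022] (held text chunk p0033 L1–60). QEC ladder PARTITION row type-07
("`IsLiftedProduct` definition if lit-3 supplies PK's printed definition with locator" — supplied:
HOME/lit/LIT-3-CONSTRUCTIONS.md D5).

## The printed definition (PK21 §III.D; PK22 App. A eq. (LP))

Let `R ⊆ Mat_ℓ(F)` be a matrix ring and `A ∈ Mat_{m_A × n_A}(R)`, `B ∈ Mat_{m_B × n_B}(R)` be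
*element-wise commuting* ("every element of `A` commutes with every element of `B`"). Put
`H_X := [A ⊗ I_{m_B}, -I_{m_A} ⊗ B]`, `H_Z := [I_{n_A} ⊗ B*, A* ⊗ I_{n_B}]` (matrices over `R`; "if the
characteristic of `𝔽_q` is 2, we can omit the sign"), where `M* = (m_{ji}ᵀ)` is the *conjugate
transpose* ("in the transposed block matrices `A*` and `B*` we also transpose each `ℓ × ℓ` block"),
and let `𝔅(M)` denote the binary (here: `F`-) block matrix of a matrix `M` over `R`, so that
`𝔅(M*) = 𝔅(M)ᵀ`. Then `𝔅(H_X) 𝔅(H_Z)ᵀ = 0 ⟺ (A ⊗ I)(I ⊗ B) = (I ⊗ B)(A ⊗ I) ⟺ a_{ij} b_{st} = b_{st} a_{ij}`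
for all `i,j,s,t`, and the CSS code with parity-check matrices `𝔅(H_X)`, `𝔅(H_Z)` is the **lifted
product** `LP(A,B)`, of length `N = ℓ (n_A m_B + n_B m_A)`. `R = F = Mat_1(F)` gives the hypergraph
product `HP(A,B)`; `1 × 1` matrices `A = (a)`, `B = (b)` over `Mat_ℓ` give the generalized bicycle
/ two-block codes `H_X = [a, -b]`, `H_Z = [bᵀ, aᵀ]`.

## What is here

* `LiftedProduct.blockStar M = Mᵀ.map (·ᵀ)` — the conjugate transpose `M*`; `𝔅` is Mathlib's
  `Matrix.comp` (block matrix ↦ flat matrix), and `𝔅(M*) = 𝔅(M)ᵀ` is Mathlib's `Matrix.transpose_comp`.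
* `LiftedProduct.ElementwiseCommute A B` — the printed hypothesis.
* `LiftedProduct.xMatrixR A B`, `LiftedProduct.zMatrixR A B` — `H_X`, `H_Z` over the block ring
  (with the sign, valid in every characteristic), and `LiftedProduct.xMatrix`, `LiftedProduct.zMatrix` —
  their flattenings `𝔅(H_X)`, `𝔅(H_Z)` over `F`, the check matrices of `LP(A,B)`; qubit index type
  `((n_A × m_B) ⊕ (m_A × n_B)) × ℓ`, of cardinality `ℓ (n_A m_B + m_A n_B)` (`card_qubitIndex`).
* `LiftedProduct.xMatrix_mul_zMatrix_transpose` — **PROVED**: element-wise commutation implies the CSS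
  condition `𝔅(H_X) 𝔅(H_Z)ᵀ = 0` (the "if" direction printed in both sources; the "only if" is not
  needed downstream and not proved here).
* `IsLiftedProduct HX HZ` — a CSS pair "is a lifted product code": up to re-indexing of checks and
  qubits it is `(𝔅(H_X), 𝔅(H_Z))` for some element-wise commuting `A`, `B` over `Mat_ℓ(F)`.

Entries of `A`, `B` are taken in the full matrix ring `Mat_ℓ(F)` (the subring `R` of the printed
definition plays no role in the construction; element-wise commutation is the operative hypothesis —
e.g. `R` commutative, or `A` in the right and `B` in the left regular representation of an algebra,
PK22 App. A). Block index `ℓ` is an arbitrary finite type.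

## Not here
Dimension formulas (`K ≥ ℓ(n_A - m_A)(m_B - n_B)`, the `𝔽_{2^r}` and `LP(A, A*)` examples), distance
bounds, the expander-based instances of PK22 (`𝒯(Γ;h) ⊗_G 𝒯*(Γ;h')`), quasi-cyclic / group-algebra
specialisations (see `QuantumCodes/AbelianTwoBlockCodes.lean` for the abelian two-block case).
-/

namespace Literature.InformationTheory.QuantumCodes

open Matrix
open scoped Kronecker

namespace LiftedProduct

variable {F : Type*} {ℓ : Type*} {I J mA nA mB nB : Type*}

section Star

/-- The **conjugate transpose** `M*` of a matrix over the block ring `Mat_ℓ(F)`: transpose the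
matrix AND each `ℓ × ℓ` block, `(M*)_{ji} = (M_{ij})ᵀ`, so that the flat matrix of `M*` is the
transpose of the flat matrix of `M` (`transpose_comp_eq`). Definition.
[cite: PanteleevKalachev2022LP, §III.D (arXiv:2012.04068 chunk p0011 L3: "conjugate transpose M* = (m_jiᵀ)", "𝔅(M*) = 𝔅(M)ᵀ")] -/
def blockStar (M : Matrix I J (Matrix ℓ ℓ F)) : Matrix J I (Matrix ℓ ℓ F) :=
  Mᵀ.map (·ᵀ)

/-- Entries of the conjugate transpose. [cite: PanteleevKalachev2022LP, §III.D (arXiv:2012.04068 chunk p0011 L3)] -/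
@[simp] theorem blockStar_apply (M : Matrix I J (Matrix ℓ ℓ F)) (j : J) (i : I) :
    blockStar M j i = (M i j)ᵀ := rfl

/-- `𝔅(M*) = 𝔅(M)ᵀ`: flattening the conjugate transpose gives the transpose of the flattening
(Mathlib's `Matrix.transpose_comp`). [cite: PanteleevKalachev2022LP, §III.D (arXiv:2012.04068 chunk p0011 L3)] -/
theorem transpose_comp_eq (M : Matrix I J (Matrix ℓ ℓ F)) :
    (Matrix.comp I J ℓ ℓ F M)ᵀ = Matrix.comp J I ℓ ℓ F (blockStar M) :=
  Matrix.transpose_comp M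

/-- `(M*)* = M`. [folklore] -/
private theorem blockStar_blockStar (M : Matrix I J (Matrix ℓ ℓ F)) :
    blockStar (blockStar M) = M := by
  ext i j a b; rfl

/-- The conjugate transpose of a column-partitioned block matrix is row-partitioned. [folklore] -/
private theorem blockStar_fromCols {J₁ J₂ : Type*} (M₁ : Matrix I J₁ (Matrix ℓ ℓ F))
    (M₂ : Matrix I J₂ (Matrix ℓ ℓ F)) :
    blockStar (fromCols M₁ M₂) = fromRows (blockStar M₁) (blockStar M₂) := by
  ext (j | j) i a b <;> rfl

end Star

section Defs

variable [CommRing F] [Fintype ℓ] [DecidableEq ℓ]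

/-- **Element-wise commuting** matrices over the block ring: every entry of `A` commutes with every
entry of `B` ("`â_{ij} b̂_{st} = b̂_{st} â_{ij}` for all `i, j, s, t`"). Definition.
[cite: PanteleevKalachev2022, App. A (arXiv:2111.03654 chunk p0033 L33-44)] -/
def ElementwiseCommute (A : Matrix mA nA (Matrix ℓ ℓ F)) (B : Matrix mB nB (Matrix ℓ ℓ F)) : Prop :=
  ∀ i j s t, A i j * B s t = B s t * A i j

variable [DecidableEq mA] [DecidableEq mB] [DecidableEq nA] [DecidableEq nB]

omit [DecidableEq nA] [DecidableEq nB] in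
/-- `H_X := [A ⊗ I_{m_B}, -I_{m_A} ⊗ B]` over the block ring `Mat_ℓ(F)` (rows `m_A × m_B`, columns
`(n_A × m_B) ⊕ (m_A × n_B)`); the sign makes the construction valid in every characteristic ("if the
characteristic of `𝔽_q` is 2, we can omit the sign"). Definition (computable).
[cite: PanteleevKalachev2022, App. A eq. (LP) (arXiv:2111.03654 chunk p0033 L13-15, L27-31)] -/
def xMatrixR (A : Matrix mA nA (Matrix ℓ ℓ F)) (B : Matrix mB nB (Matrix ℓ ℓ F)) :
    Matrix (mA × mB) ((nA × mB) ⊕ (mA × nB)) (Matrix ℓ ℓ F) :=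
  fromCols (A ⊗ₖ (1 : Matrix mB mB (Matrix ℓ ℓ F))) (-((1 : Matrix mA mA (Matrix ℓ ℓ F)) ⊗ₖ B))

omit [DecidableEq mA] [DecidableEq mB] in
/-- `H_Z := [I_{n_A} ⊗ B*, A* ⊗ I_{n_B}]` over the block ring `Mat_ℓ(F)` (rows `n_A × n_B`, same
columns as `H_X`), `*` = conjugate transpose `blockStar`. Definition (computable).
[cite: PanteleevKalachev2022, App. A eq. (LP) (arXiv:2111.03654 chunk p0033 L13-15, L27-31)] -/
def zMatrixR (A : Matrix mA nA (Matrix ℓ ℓ F)) (B : Matrix mB nB (Matrix ℓ ℓ F)) :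
    Matrix (nA × nB) ((nA × mB) ⊕ (mA × nB)) (Matrix ℓ ℓ F) :=
  fromCols ((1 : Matrix nA nA (Matrix ℓ ℓ F)) ⊗ₖ blockStar B) (blockStar A ⊗ₖ (1 : Matrix nB nB _))

omit [DecidableEq nA] [DecidableEq nB] in
/-- The `X`-check matrix `𝔅(H_X)` of the lifted product code `LP(A,B)`: the flat `F`-matrix of
`xMatrixR A B` (rows `(m_A × m_B) × ℓ`, qubits `((n_A × m_B) ⊕ (m_A × n_B)) × ℓ`). Definition
(computable). [cite: PanteleevKalachev2022LP, §III.D (arXiv:2012.04068 chunk p0011 L5-12, L41-45)] -/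
def xMatrix (A : Matrix mA nA (Matrix ℓ ℓ F)) (B : Matrix mB nB (Matrix ℓ ℓ F)) :
    Matrix ((mA × mB) × ℓ) (((nA × mB) ⊕ (mA × nB)) × ℓ) F :=
  Matrix.comp _ _ ℓ ℓ F (xMatrixR A B)

omit [DecidableEq mA] [DecidableEq mB] in
/-- The `Z`-check matrix `𝔅(H_Z)` of the lifted product code `LP(A,B)`: the flat `F`-matrix of
`zMatrixR A B`. Definition (computable).
[cite: PanteleevKalachev2022LP, §III.D (arXiv:2012.04068 chunk p0011 L5-12, L41-45)] -/
def zMatrix (A : Matrix mA nA (Matrix ℓ ℓ F)) (B : Matrix mB nB (Matrix ℓ ℓ F)) :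
    Matrix ((nA × nB) × ℓ) (((nA × mB) ⊕ (mA × nB)) × ℓ) F :=
  Matrix.comp _ _ ℓ ℓ F (zMatrixR A B)

end Defs

/-- The code length of `LP(A,B)`: the qubit index type has `ℓ (n_A m_B + m_A n_B)` elements
("`N = ℓ(n_A m_B + n_B m_A)`"). [cite: PanteleevKalachev2022LP, §III.D (arXiv:2012.04068 chunk p0011 L45)] -/
theorem card_qubitIndex [Fintype ℓ] [Fintype mA] [Fintype nA] [Fintype mB] [Fintype nB] :
    Fintype.card ((((nA × mB) ⊕ (mA × nB)) × ℓ)) =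
      Fintype.card ℓ * (Fintype.card nA * Fintype.card mB + Fintype.card mA * Fintype.card nB) := by
  simp only [Fintype.card_prod, Fintype.card_sum]
  ring

/-! ### The CSS condition from element-wise commutation -/

section Comm

variable [CommRing F] [Fintype ℓ]

/-- Flattening is multiplicative on block matrices with square blocks: `𝔅(M N) = 𝔅(M) 𝔅(N)`
(Mathlib has the square-outer-shape case as `Matrix.compRingEquiv`). [folklore] -/
private theorem comp_mul {P : Type*} [Fintype P] (M : Matrix I P (Matrix ℓ ℓ F))
    (N : Matrix P J (Matrix ℓ ℓ F)) :
    Matrix.comp I J ℓ ℓ F (M * N) = Matrix.comp I P ℓ ℓ F M * Matrix.comp P J ℓ ℓ F N := by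
  ext ⟨i, k⟩ ⟨j, l⟩
  exact Matrix.sum_apply .. |>.trans <| .symm <| Fintype.sum_prod_type ..

variable [DecidableEq ℓ]

/-- Entries of `(A ⊗ I)(I ⊗ B)`: `((i,j),(k,l)) ↦ A_{ik} B_{jl}`. [folklore] -/
private theorem kron_one_mul_one_kron [DecidableEq mB] [DecidableEq nA] [Fintype nA] [Fintype mB]
    (A : Matrix mA nA (Matrix ℓ ℓ F)) (B : Matrix mB nB (Matrix ℓ ℓ F))
    (i : mA) (j : mB) (k : nA) (l : nB) :
    ((A ⊗ₖ (1 : Matrix mB mB (Matrix ℓ ℓ F))) * ((1 : Matrix nA nA (Matrix ℓ ℓ F)) ⊗ₖ B))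
      (i, j) (k, l) = A i k * B j l := by
  rw [Matrix.mul_apply, Fintype.sum_prod_type]
  simp only [kroneckerMap_apply, Matrix.one_apply, mul_ite, mul_one, mul_zero, ite_mul, one_mul,
    zero_mul]
  rw [Finset.sum_eq_single k]
  · simp
  · intro p _ hp; simp [hp]
  · simp

/-- Entries of `(I ⊗ B)(A ⊗ I)`: `((i,j),(k,l)) ↦ B_{jl} A_{ik}`. [folklore] -/
private theorem one_kron_mul_kron_one [DecidableEq mA] [DecidableEq nB] [Fintype mA] [Fintype nB]
    (A : Matrix mA nA (Matrix ℓ ℓ F)) (B : Matrix mB nB (Matrix ℓ ℓ F))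
    (i : mA) (j : mB) (k : nA) (l : nB) :
    (((1 : Matrix mA mA (Matrix ℓ ℓ F)) ⊗ₖ B) * (A ⊗ₖ (1 : Matrix nB nB (Matrix ℓ ℓ F))))
      (i, j) (k, l) = B j l * A i k := by
  rw [Matrix.mul_apply, Fintype.sum_prod_type]
  simp only [kroneckerMap_apply, Matrix.one_apply, mul_ite, mul_one, mul_zero, ite_mul, one_mul,
    zero_mul]
  rw [Finset.sum_eq_single i]
  · simp
  · intro p _ hp; simp [Ne.symm hp]
  · simp

variable [DecidableEq mA] [DecidableEq mB] [DecidableEq nA] [DecidableEq nB]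
variable [Fintype mA] [Fintype nA] [Fintype mB] [Fintype nB]

/-- **The CSS condition of the lifted product (PROVED).** If `A` and `B` are element-wise commuting,
then `𝔅(H_X) 𝔅(H_Z)ᵀ = 0`: "if every element of `Â` commutes with every element of `B̂`, then this
construction always gives a quantum CSS code … `Ĥ_X Ĥ_Z* = 0 ⟺ (Â ⊗ I_{m_b})(I_{n_a} ⊗ B̂) =
(I_{m_a} ⊗ B̂)(Â ⊗ I_{n_b})`". (Only the printed "if" direction is proved.)
[cite: PanteleevKalachev2022, App. A (arXiv:2111.03654 chunk p0033 L32-44); PanteleevKalachev2022LP, §III.D (arXiv:2012.04068 chunk p0011 L12-41)] -/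
theorem xMatrix_mul_zMatrix_transpose {A : Matrix mA nA (Matrix ℓ ℓ F)}
    {B : Matrix mB nB (Matrix ℓ ℓ F)} (hAB : ElementwiseCommute A B) :
    xMatrix A B * (zMatrix A B)ᵀ = 0 := by
  -- work over the block ring: `𝔅(H_X) 𝔅(H_Z)ᵀ = 𝔅(H_X) 𝔅(H_Z*) = 𝔅(H_X H_Z*)`
  rw [zMatrix, transpose_comp_eq, xMatrix, ← comp_mul]
  have h0 : xMatrixR A B * blockStar (zMatrixR A B) = 0 := by
    rw [zMatrixR, blockStar_fromCols, xMatrixR, fromCols_mul_fromRows]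
    -- `(1 ⊗ B*)* = 1 ⊗ B`, `(A* ⊗ 1)* = A ⊗ 1`
    have h1 : blockStar ((1 : Matrix nA nA (Matrix ℓ ℓ F)) ⊗ₖ blockStar B) =
        (1 : Matrix nA nA (Matrix ℓ ℓ F)) ⊗ₖ B := by
      ext ⟨k, l⟩ ⟨k', j⟩ : 2
      simp only [blockStar_apply, kroneckerMap_apply, Matrix.one_apply]
      by_cases h : k = k'
      · subst h; simp
      · simp [h, Ne.symm h]
    have h2 : blockStar (blockStar A ⊗ₖ (1 : Matrix nB nB (Matrix ℓ ℓ F))) =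
        A ⊗ₖ (1 : Matrix nB nB (Matrix ℓ ℓ F)) := by
      ext ⟨i, l⟩ ⟨k, l'⟩ : 2
      simp only [blockStar_apply, kroneckerMap_apply, Matrix.one_apply]
      by_cases h : l = l'
      · subst h; simp
      · simp [h, Ne.symm h]
    rw [h1, h2, Matrix.neg_mul]
    ext ⟨i, j⟩ ⟨k, l⟩ : 2
    simp only [Matrix.add_apply, Matrix.neg_apply, kron_one_mul_one_kron, one_kron_mul_kron_one,
      hAB i k j l, add_neg_cancel, Matrix.zero_apply]
  rw [h0]
  rfl

end Comm

end LiftedProduct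

/-- **A CSS pair is a lifted product code** `LP(A,B)`: up to re-indexing of the checks and of the
qudits, `(H_X, H_Z) = (𝔅([A ⊗ I, -I ⊗ B]), 𝔅([I ⊗ B*, A* ⊗ I]))` for some finite block index `ℓ` and
element-wise commuting matrices `A`, `B` with entries in `Mat_ℓ(F)`. Definition.
[cite: PanteleevKalachev2022LP, §III.D (arXiv:2012.04068 chunk p0011 L41-44: "We denote this code by LP(A,B) and call the lifted product (LP) code"); PanteleevKalachev2022, App. A (arXiv:2111.03654 chunk p0033 L27-40)] -/
def IsLiftedProduct {F : Type*} [CommRing F] {RX RZ Q : Type*} (HX : Matrix RX Q F)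
    (HZ : Matrix RZ Q F) : Prop :=
  ∃ (l ma na mb nb : ℕ) (A : Matrix (Fin ma) (Fin na) (Matrix (Fin l) (Fin l) F))
    (B : Matrix (Fin mb) (Fin nb) (Matrix (Fin l) (Fin l) F))
    (eX : RX ≃ (Fin ma × Fin mb) × Fin l) (eZ : RZ ≃ (Fin na × Fin nb) × Fin l)
    (eQ : Q ≃ ((Fin na × Fin mb) ⊕ (Fin ma × Fin nb)) × Fin l),
    LiftedProduct.ElementwiseCommute A B ∧
      HX = Matrix.reindex eX.symm eQ.symm (LiftedProduct.xMatrix A B) ∧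
      HZ = Matrix.reindex eZ.symm eQ.symm (LiftedProduct.zMatrix A B)

end Literature.InformationTheory.QuantumCodes
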